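import Summits.Ventures.CertifiedQuantumChemistry.Rows.HubbardRingKernel
import HarnessLib

/-!
# Ventures/CertifiedQuantumChemistry — Rows/HubbardRingL6StrongCouplingForm.lean: the second-order form of the
# half-filled 6-ring on its twenty singly occupied configurations, `Q(x) ≤ (10 + 2√13)|x|²` with equality
# (T-K0-6, part 1 of 2)

HONEST FRAMING (verbatim): certified bounds for a stated model Hamiltonian in a stated basis; not a
claim about the real molecule beyond that model.

Seat ref/typer (`pub-qchem-typer`, gen 19). The 6-ring analogue of T-K0-4 — NOTED by the lead as 'the ONE
words-step under §2.2.14.2's L = 6 floors (U·E₀(6;U) → −2(5 + √13)) … a finite exact computation on the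
twenty singly-occupied (3,3) configurations of the 6-ring over ℚ(√13) — NOT asked, no clock, the typer's
discretion' (HOME/INBOX L802 (2), RULINGS TYP-47). THEOREMS ONLY (no `def`, no claim node, no row), zero
compute, standard axioms; NOT a row, scores nothing, moves no `CERTIFIED.md` byte. Part 2 =
`Rows/HubbardRingL6StrongCouplingLimit.lean` (coordinates, the value `E_{K₀}(−A²) = −(10 + 2√13)` and the
limit statements).

## What is proved

* §5 `sum_mul_mul_le_of_pos_eigenvector` — the GROUND-STATE SUBSTITUTION bound (Collatz–Wielandt /
  Perron–Frobenius upper bound): a real symmetric array `M` with non-negative off-diagonal entries and a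
  positive vector `w` with `M w = μ w` satisfies `Σ_{ab} M_{ab} x_a x_b ≤ μ Σ_a x_a²` for all real `x`
  (termwise `2x_a x_b ≤ (w_b/w_a)x_a² + (w_a/w_b)x_b²`). Generic (`ι` any `Fintype`).
* §6 the 6-ring (`Rows/HubbardRingKernel.lean`'s `r6s3`, `r6K3`, `r6d33`): the singly occupied `(3,3)`
  configurations are the antidiagonal `(r6s3 i, r6s3 (rev i))` (`r6d33_eq_zero_iff`, kernel); the real form
  `Q(x) = Σ_{pq} (K_{p,rev q} x_{rev q} + x_p K_{rev p,q})²` (`K = r6K3`) is the quadratic form of the INTEGER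
  array `M_{ab} = Σ_{pq} c_{pq}(a) c_{pq}(b)`, `c_{pq}(a) = [a = rev q] K_{p,rev q} + [a = p] K_{rev p,q}`
  (`ring6_realForm_eq_sum_coeff`, structural); **`ring6_coeff_table`** (kernel evaluation, `decide`): `M`
  is the literal `20 × 20` table written in the proof (diagonal `4/8/12`, off-diagonal `0/2` — all
  NON-NEGATIVE in these coordinates), symmetric, and the integer vectors
  `α = (2,3,3,2,3,8,3,3,3,2,2,3,3,3,8,3,2,3,3,2)`, `β = (0,1,1,0,1,2,1,1,1,0,0,1,1,1,2,1,0,1,1,0)` (`α > 0`,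
  `β ≥ 0`) satisfy `M α = 10α + 26β`, `M β = 2α + 10β` — i.e. `w = α + β√13` (`1 : (3+√13)/2 : 4+√13` on the
  diagonal classes `4 : 8 : 12`) is a positive eigenvector of `M` with eigenvalue `μ = 10 + 2√13 = 2(5+√13)`;
  **`ring6_realForm_le_and_eq`**: `Q(x) ≤ (10 + 2√13) Σ x_a²` for all real `x`, with EQUALITY at the positive
  vector `w`; `ring6_complexForm_le` (real and imaginary parts). Independent stdlib numerics
  (`HOME/pub-qchem-typer/staged/g19/check6.py`, `form6.py`): full `2¹²` Jordan–Wigner build, `(3,3)` sector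
  `400`, `Z = 20`, `P A P = 0` and the one-doublon property hold, `eig P A² P|_Z` max `= 17.2111025509 = 2(5+√13)`
  (simple; spectrum `{0, 2, 2, 2.79, 2.88, 2.88, 4, 5.53, 6, 6, 8, 8, 8, 10, 10, 11.12, 11.12, 12, 14.47, 17.21}`),
  `M`, `α`, `β` and `M w = μ w` exact over `ℚ(√13)`.

References: as T-K0-4 (Kato 1966 Ch. II §2.3 [Kato1966]; Takahashi 1999 §6.4 [Takahashi1999]; Lieb 1989 eq. (4)
[LiebPRL1989]); the bound of §5 is the finite-dimensional Collatz–Wielandt inequality (e.g. Horn–Johnson,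
*Matrix Analysis* (2013) §8.1, Cor. 8.1.29 / Thm 8.1.26), proved here from scratch. Typer `pub-qchem-typer`
(gen 19), 0 core-h.
-/

noncomputable section

namespace Summit.Ventures.CertifiedQuantumChemistry

open Matrix Finset Filter Topology
open Literature.MathematicalPhysics.QuantumLattice Literature.MathematicalPhysics.QuantumChemistry
open Literature.MathematicalPhysics.QuantumLattice.TwoSpecies LiebThm1
open Summit.Ventures.CertifiedQuantumChemistry.Hamiltonians

/-! ## §5 The ground-state substitution bound (the Collatz–Wielandt / Perron–Frobenius upper bound for a
quadratic form with non-negative off-diagonal coefficients and a positive eigenvector) -/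

section Perron

variable {ι : Type*} [Fintype ι]

/-- **Ground-state substitution bound.** If a real symmetric coefficient array `M` has non-negative
OFF-DIAGONAL entries and a componentwise POSITIVE vector `w` with `Σ_b M a b · w b = μ · w a` for every `a`,
then `Σ_{ab} M a b · x a · x b ≤ μ · Σ_a (x a)²` for every real `x` (termwise
`2 x_a x_b ≤ (w_b/w_a) x_a² + (w_a/w_b) x_b²`, then the eigen-equation; the discrete 'ground-state
transformation', equivalently the Collatz–Wielandt formula for the Perron root read as an upper bound). -/
theorem sum_mul_mul_le_of_pos_eigenvector (M : ι → ι → ℝ) (hsymm : ∀ a b, M a b = M b a)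
    (hoff : ∀ a b, a ≠ b → 0 ≤ M a b) {w : ι → ℝ} (hw : ∀ a, 0 < w a) {μ : ℝ}
    (heig : ∀ a, ∑ b, M a b * w b = μ * w a) (x : ι → ℝ) :
    ∑ a, ∑ b, M a b * (x a * x b) ≤ μ * ∑ a, x a ^ 2 := by
  classical
  have hterm : ∀ a b, M a b * (x a * x b) ≤ M a b * ((w b * x a ^ 2 / w a + w a * x b ^ 2 / w b) / 2) := by
    intro a b
    by_cases hab : a = b
    · subst hab
      have hwa := hw a
      have : (w a * x a ^ 2 / w a + w a * x a ^ 2 / w a) / 2 = x a * x a := by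
        field_simp
        ring
      rw [this]
    · refine mul_le_mul_of_nonneg_left ?_ (hoff a b hab)
      have hwa := hw a
      have hwb := hw b
      rw [le_div_iff₀ (by norm_num : (0:ℝ) < 2), div_add_div _ _ hwa.ne' hwb.ne', le_div_iff₀ (mul_pos hwa hwb)]
      nlinarith [sq_nonneg (w b * x a - w a * x b), mul_pos hwa hwb]
  have hsum : ∑ a, ∑ b, M a b * ((w b * x a ^ 2 / w a + w a * x b ^ 2 / w b) / 2) =
      ∑ a, ∑ b, M a b * (w b * x a ^ 2 / w a) := by
    have h1 : ∑ a, ∑ b, M a b * (w a * x b ^ 2 / w b) = ∑ a, ∑ b, M a b * (w b * x a ^ 2 / w a) := by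
      rw [Finset.sum_comm]
      exact Finset.sum_congr rfl fun a _ => Finset.sum_congr rfl fun b _ => by rw [hsymm b a]
    have h2 : ∑ a, ∑ b, M a b * ((w b * x a ^ 2 / w a + w a * x b ^ 2 / w b) / 2) =
        (∑ a, ∑ b, M a b * (w b * x a ^ 2 / w a) + ∑ a, ∑ b, M a b * (w a * x b ^ 2 / w b)) / 2 := by
      rw [← Finset.sum_add_distrib, Finset.sum_div]
      refine Finset.sum_congr rfl fun a _ => ?_
      rw [← Finset.sum_add_distrib, Finset.sum_div]
      exact Finset.sum_congr rfl fun b _ => by ring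
    rw [h2, h1]
    ring
  have heig' : ∀ a, ∑ b, M a b * (w b * x a ^ 2 / w a) = μ * x a ^ 2 := by
    intro a
    have hwa := hw a
    have : ∑ b, M a b * (w b * x a ^ 2 / w a) = (∑ b, M a b * w b) * (x a ^ 2 / w a) := by
      rw [Finset.sum_mul]
      exact Finset.sum_congr rfl fun b _ => by ring
    rw [this, heig a]
    field_simp
  calc ∑ a, ∑ b, M a b * (x a * x b)
      ≤ ∑ a, ∑ b, M a b * ((w b * x a ^ 2 / w a + w a * x b ^ 2 / w b) / 2) :=
        Finset.sum_le_sum fun a _ => Finset.sum_le_sum fun b _ => hterm a b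
    _ = ∑ a, ∑ b, M a b * (w b * x a ^ 2 / w a) := hsum
    _ = ∑ a, μ * x a ^ 2 := Finset.sum_congr rfl fun a _ => heig' a
    _ = μ * ∑ a, x a ^ 2 := by rw [Finset.mul_sum]

end Perron

/-! ## §6 The half-filled 6-ring: the coefficient array of `‖Aφ‖²` on the twenty singly occupied `(3,3)`
configurations, its Perron vector over `ℚ(√13)`, and the bound `‖Aφ‖² ≤ (10 + 2√13)‖φ‖²`

In Lieb's coordinates of `Rows/HubbardRingKernel.lean` (`r6s3`, `r6K3`, `r6d33`) the singly occupied
`(3,3)` configurations of the 6-ring are the antidiagonal `(r6s3 i, r6s3 (rev i))`; for `x : Fin 20 → ℝ` the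
form is `Q(x) = Σ_{pq} T_{pq}(x)²`, `T_{pq}(x) = K_{p,rev q} x_{rev q} + x_p K_{rev p,q} = Σ_a c_{pq}(a) x_a`,
`c_{pq}(a) = [a = rev q] K_{p,rev q} + [a = p] K_{rev p,q}`, so `Q(x) = Σ_{ab} M_{ab} x_a x_b` with the INTEGER
array `M_{ab} = Σ_{pq} c_{pq}(a) c_{pq}(b)` (diagonal `4, 8, 8, 4, 8, 12, 8, 8, 8, 4, 4, 8, 8, 8, 12, 8, 4, 8, 8, 4`,
off-diagonal entries `0` or `2` — all NON-NEGATIVE in these coordinates). Its Perron vector is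
`w_a = α_a + β_a √13` with `(α, β) = (2, 0), (3, 1), (8, 2)` on the diagonal classes `4, 8, 12`
(`1 : (3+√13)/2 : 4+√13`), eigenvalue `μ = 10 + 2√13 = 2(5 + √13)`: the two INTEGER identities
`Σ_b M_{ab} α_b = 10α_a + 26β_a`, `Σ_b M_{ab} β_b = 2α_a + 10β_a` (kernel evaluation) are `M w = μ w` split
along `1, √13`. (Numerically the spectrum of `M` is `{0, 2, 2, 2.79, 2.88, 2.88, 4, 5.53, 6, 6, 8, 8, 8, 10, 10,
11.12, 11.12, 12, 14.47, 17.21}`, `staged/g19/check6.py`; only its top `10 + 2√13` is certified here.) -/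

section Ring6Form

/-- `|r6s3 i ∩ r6s3 j| = 0` exactly on the antidiagonal `j = rev i` (kernel evaluation). -/
theorem r6d33_eq_zero_iff : ∀ i j : Fin 20, r6d33 i j = 0 ↔ j = i.rev := by decide

/-- The form `Q(x) = Σ_{pq} (K_{p,rev q} x_{rev q} + x_p K_{rev p,q})²` as the quadratic form of the integer
coefficient array `M_{ab} = Σ_{pq} c_{pq}(a) c_{pq}(b)`. -/
theorem ring6_realForm_eq_sum_coeff (x : Fin 20 → ℝ) :
    ∑ p : Fin 20, ∑ q : Fin 20, ((r6K3 p q.rev : ℝ) * x q.rev + x p * (r6K3 p.rev q : ℝ)) ^ 2 =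
      ∑ a : Fin 20, ∑ b : Fin 20, ((∑ p : Fin 20, ∑ q : Fin 20,
        ((if a = q.rev then r6K3 p q.rev else 0) + (if a = p then r6K3 p.rev q else 0)) *
          ((if b = q.rev then r6K3 p q.rev else 0) + (if b = p then r6K3 p.rev q else 0)) : ℤ) : ℝ) *
        (x a * x b) := by
  -- each `T_pq(x)` as `Σ_a c_pq(a) x_a`
  have hT : ∀ p q : Fin 20, (r6K3 p q.rev : ℝ) * x q.rev + x p * (r6K3 p.rev q : ℝ) =
      ∑ a : Fin 20, (((if a = q.rev then r6K3 p q.rev else 0) + (if a = p then r6K3 p.rev q else 0) : ℤ) : ℝ)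
        * x a := by
    intro p q
    simp only [Int.cast_add, Int.cast_ite, Int.cast_zero, add_mul, Finset.sum_add_distrib, ite_mul, zero_mul,
      Finset.sum_ite_eq', Finset.mem_univ, if_true]
    ring
  simp_rw [hT, sq, Finset.sum_mul_sum]
  -- move `Σ_p Σ_q` inside `Σ_a Σ_b`
  calc ∑ p : Fin 20, ∑ q : Fin 20, ∑ a : Fin 20, ∑ b : Fin 20,
        (((if a = q.rev then r6K3 p q.rev else 0) + (if a = p then r6K3 p.rev q else 0) : ℤ) : ℝ) * x a *
          ((((if b = q.rev then r6K3 p q.rev else 0) + (if b = p then r6K3 p.rev q else 0) : ℤ) : ℝ) * x b)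
      = ∑ p : Fin 20, ∑ a : Fin 20, ∑ q : Fin 20, ∑ b : Fin 20,
        (((if a = q.rev then r6K3 p q.rev else 0) + (if a = p then r6K3 p.rev q else 0) : ℤ) : ℝ) * x a *
          ((((if b = q.rev then r6K3 p q.rev else 0) + (if b = p then r6K3 p.rev q else 0) : ℤ) : ℝ) * x b) :=
        Finset.sum_congr rfl fun _ _ => Finset.sum_comm
    _ = ∑ a : Fin 20, ∑ p : Fin 20, ∑ q : Fin 20, ∑ b : Fin 20,
        (((if a = q.rev then r6K3 p q.rev else 0) + (if a = p then r6K3 p.rev q else 0) : ℤ) : ℝ) * x a *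
          ((((if b = q.rev then r6K3 p q.rev else 0) + (if b = p then r6K3 p.rev q else 0) : ℤ) : ℝ) * x b) :=
        Finset.sum_comm
    _ = ∑ a : Fin 20, ∑ p : Fin 20, ∑ b : Fin 20, ∑ q : Fin 20,
        (((if a = q.rev then r6K3 p q.rev else 0) + (if a = p then r6K3 p.rev q else 0) : ℤ) : ℝ) * x a *
          ((((if b = q.rev then r6K3 p q.rev else 0) + (if b = p then r6K3 p.rev q else 0) : ℤ) : ℝ) * x b) :=
        Finset.sum_congr rfl fun _ _ => Finset.sum_congr rfl fun _ _ => Finset.sum_comm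
    _ = ∑ a : Fin 20, ∑ b : Fin 20, ∑ p : Fin 20, ∑ q : Fin 20,
        (((if a = q.rev then r6K3 p q.rev else 0) + (if a = p then r6K3 p.rev q else 0) : ℤ) : ℝ) * x a *
          ((((if b = q.rev then r6K3 p q.rev else 0) + (if b = p then r6K3 p.rev q else 0) : ℤ) : ℝ) * x b) :=
        Finset.sum_congr rfl fun _ _ => Finset.sum_comm
    _ = _ := by
        refine Finset.sum_congr rfl fun a _ => Finset.sum_congr rfl fun b _ => ?_
        rw [Int.cast_sum, Finset.sum_mul]
        refine Finset.sum_congr rfl fun p _ => ?_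
        rw [Int.cast_sum, Finset.sum_mul]
        refine Finset.sum_congr rfl fun q _ => ?_
        rw [Int.cast_mul]
        ring

/-- **The coefficient array and its Perron vector over `ℚ(√13)` (kernel evaluation).** There are an
integer array `M` (the literal `20 × 20` table of `Σ_{pq} c_{pq}(a) c_{pq}(b)`: diagonal `4/8/12`,
off-diagonal `0/2`) and integer vectors `α = (2,3,3,2,3,8,3,3,3,2,2,3,3,3,8,3,2,3,3,2)`,
`β = (0,1,1,0,1,2,1,1,1,0,0,1,1,1,2,1,0,1,1,0)` with: `M` = the coefficient array, `M ≥ 0` entrywise,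
`M` symmetric, `α > 0`, `β ≥ 0`, and `M α = 10α + 26β`, `M β = 2α + 10β` — i.e. `M (α + β√13) =
(10 + 2√13)(α + β√13)`. -/
theorem ring6_coeff_table : ∃ (M : Fin 20 → Fin 20 → ℤ) (α β : Fin 20 → ℤ),
    (∀ a b : Fin 20, (∑ p : Fin 20, ∑ q : Fin 20,
      (((if a = q.rev then r6K3 p q.rev else 0) + (if a = p then r6K3 p.rev q else 0)) *
        ((if b = q.rev then r6K3 p q.rev else 0) + (if b = p then r6K3 p.rev q else 0)))) = M a b) ∧
    (∀ a b, 0 ≤ M a b) ∧ (∀ a b, M a b = M b a) ∧ (∀ a, 0 < α a ∧ 0 ≤ β a) ∧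
    (∀ a, ∑ b, M a b * α b = 10 * α a + 26 * β a) ∧ (∀ a, ∑ b, M a b * β b = 2 * α a + 10 * β a) := by
  refine ⟨![![4, 2, 0, 0, 0, 0, 0, 0, 0, 0, 0, 0, 2, 0, 0, 0, 0, 0, 0, 0],
    ![2, 8, 2, 0, 2, 0, 0, 0, 0, 0, 0, 0, 0, 0, 2, 0, 0, 0, 0, 0],
    ![0, 2, 8, 2, 0, 2, 0, 0, 0, 0, 0, 0, 0, 0, 0, 2, 0, 0, 0, 0],
    ![0, 0, 2, 4, 0, 0, 2, 0, 0, 0, 0, 0, 0, 0, 0, 0, 0, 0, 0, 0],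
    ![0, 2, 0, 0, 8, 2, 0, 0, 0, 0, 2, 0, 0, 0, 0, 0, 0, 2, 0, 0],
    ![0, 0, 2, 0, 2, 12, 2, 2, 0, 0, 0, 2, 0, 0, 0, 0, 0, 0, 2, 0],
    ![0, 0, 0, 2, 0, 2, 8, 0, 2, 0, 0, 0, 2, 0, 0, 0, 0, 0, 0, 0],
    ![0, 0, 0, 0, 0, 2, 0, 8, 2, 0, 0, 0, 0, 2, 0, 0, 0, 0, 0, 2],
    ![0, 0, 0, 0, 0, 0, 2, 2, 8, 2, 0, 0, 0, 0, 2, 0, 0, 0, 0, 0],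
    ![0, 0, 0, 0, 0, 0, 0, 0, 2, 4, 0, 0, 0, 0, 0, 2, 0, 0, 0, 0],
    ![0, 0, 0, 0, 2, 0, 0, 0, 0, 0, 4, 2, 0, 0, 0, 0, 0, 0, 0, 0],
    ![0, 0, 0, 0, 0, 2, 0, 0, 0, 0, 2, 8, 2, 2, 0, 0, 0, 0, 0, 0],
    ![2, 0, 0, 0, 0, 0, 2, 0, 0, 0, 0, 2, 8, 0, 2, 0, 0, 0, 0, 0],
    ![0, 0, 0, 0, 0, 0, 0, 2, 0, 0, 0, 2, 0, 8, 2, 0, 2, 0, 0, 0],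
    ![0, 2, 0, 0, 0, 0, 0, 0, 2, 0, 0, 0, 2, 2, 12, 2, 0, 2, 0, 0],
    ![0, 0, 2, 0, 0, 0, 0, 0, 0, 2, 0, 0, 0, 0, 2, 8, 0, 0, 2, 0],
    ![0, 0, 0, 0, 0, 0, 0, 0, 0, 0, 0, 0, 0, 2, 0, 0, 4, 2, 0, 0],
    ![0, 0, 0, 0, 2, 0, 0, 0, 0, 0, 0, 0, 0, 0, 2, 0, 2, 8, 2, 0],
    ![0, 0, 0, 0, 0, 2, 0, 0, 0, 0, 0, 0, 0, 0, 0, 2, 0, 2, 8, 2],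
    ![0, 0, 0, 0, 0, 0, 0, 2, 0, 0, 0, 0, 0, 0, 0, 0, 0, 0, 2, 4]],
    ![2, 3, 3, 2, 3, 8, 3, 3, 3, 2, 2, 3, 3, 3, 8, 3, 2, 3, 3, 2],
    ![0, 1, 1, 0, 1, 2, 1, 1, 1, 0, 0, 1, 1, 1, 2, 1, 0, 1, 1, 0], ?_, ?_, ?_, ?_, ?_, ?_⟩
  · decide +kernel
  · decide
  · decide
  · decide
  · decide
  · decide

/-- `√13` bookkeeping: `√13 · √13 = 13`. -/
theorem sqrt13_mul_self : Real.sqrt 13 * Real.sqrt 13 = 13 :=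
  Real.mul_self_sqrt (by norm_num)

/-- Splitting a sum along `1, s`: `Σ_b f b (g b + h b · s) = Σ f g + (Σ f h) · s`. -/
theorem sum_mul_add_mul_eq {ι : Type*} [Fintype ι] (f g h : ι → ℝ) (s : ℝ) :
    ∑ b, f b * (g b + h b * s) = (∑ b, f b * g b) + (∑ b, f b * h b) * s := by
  rw [Finset.sum_mul, ← Finset.sum_add_distrib]
  exact Finset.sum_congr rfl fun b _ => by ring

/-- **`‖Aφ‖² ≤ (10 + 2√13) ‖φ‖²` on `K₀`, real form**: for every `x : Fin 20 → ℝ`,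
`Σ_{pq} (K_{p,rev q} x_{rev q} + x_p K_{rev p,q})² ≤ (10 + 2√13) Σ_a x_a²` — the ground-state substitution
bound with the Perron vector `α + β√13`; and the bound is ATTAINED at a positive vector. -/
theorem ring6_realForm_le_and_eq :
    (∀ x : Fin 20 → ℝ,
      ∑ p : Fin 20, ∑ q : Fin 20, ((r6K3 p q.rev : ℝ) * x q.rev + x p * (r6K3 p.rev q : ℝ)) ^ 2 ≤
        (10 + 2 * Real.sqrt 13) * ∑ a : Fin 20, x a ^ 2) ∧
    ∃ w : Fin 20 → ℝ, (∀ a, 0 < w a) ∧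
      ∑ p : Fin 20, ∑ q : Fin 20, ((r6K3 p q.rev : ℝ) * w q.rev + w p * (r6K3 p.rev q : ℝ)) ^ 2 =
        (10 + 2 * Real.sqrt 13) * ∑ a : Fin 20, w a ^ 2 := by
  obtain ⟨M, α, β, hMeq, hnonneg, hsymm, hpos, h1, h2⟩ := ring6_coeff_table
  set s : ℝ := Real.sqrt 13 with hs
  have hss : s * s = 13 := sqrt13_mul_self
  have hs0 : 0 ≤ s := Real.sqrt_nonneg 13
  -- the form through `M`
  have hform : ∀ x : Fin 20 → ℝ,
      ∑ p : Fin 20, ∑ q : Fin 20, ((r6K3 p q.rev : ℝ) * x q.rev + x p * (r6K3 p.rev q : ℝ)) ^ 2 =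
        ∑ a, ∑ b, (M a b : ℝ) * (x a * x b) := by
    intro x
    rw [ring6_realForm_eq_sum_coeff]
    simp only [hMeq]
  -- the Perron vector and its eigen-equation over `ℝ`
  have hwpos : ∀ a, 0 < (α a : ℝ) + (β a : ℝ) * s := by
    intro a
    have h := hpos a
    have hα : (0 : ℝ) < (α a : ℝ) := by exact_mod_cast h.1
    have hβ : (0 : ℝ) ≤ (β a : ℝ) := by exact_mod_cast h.2
    nlinarith [mul_nonneg hβ hs0]
  have heig : ∀ a, ∑ b, (M a b : ℝ) * ((α b : ℝ) + (β b : ℝ) * s) =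
      (10 + 2 * s) * ((α a : ℝ) + (β a : ℝ) * s) := by
    intro a
    have h1c : ∑ b, (M a b : ℝ) * (α b : ℝ) = 10 * (α a : ℝ) + 26 * (β a : ℝ) := by exact_mod_cast h1 a
    have h2c : ∑ b, (M a b : ℝ) * (β b : ℝ) = 2 * (α a : ℝ) + 10 * (β a : ℝ) := by exact_mod_cast h2 a
    rw [sum_mul_add_mul_eq, h1c, h2c]
    linear_combination (-2 * (β a : ℝ)) * hss
  refine ⟨fun x => ?_, ⟨fun a => (α a : ℝ) + (β a : ℝ) * s, hwpos, ?_⟩⟩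
  · rw [hform]
    exact sum_mul_mul_le_of_pos_eigenvector (fun a b => (M a b : ℝ))
      (fun a b => by exact_mod_cast hsymm a b) (fun a b _ => by exact_mod_cast hnonneg a b)
      hwpos heig x
  · have h := hform (fun a => (α a : ℝ) + (β a : ℝ) * s)
    beta_reduce at h
    beta_reduce
    rw [h, Finset.mul_sum]
    refine Finset.sum_congr rfl fun a _ => ?_
    have hrow : ∑ b, (M a b : ℝ) * ((((α a : ℝ) + (β a : ℝ) * s)) * ((α b : ℝ) + (β b : ℝ) * s)) =
        ((α a : ℝ) + (β a : ℝ) * s) * ∑ b, (M a b : ℝ) * ((α b : ℝ) + (β b : ℝ) * s) := by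
      rw [Finset.mul_sum]
      exact Finset.sum_congr rfl fun b _ => by ring
    rw [hrow, heig a]
    ring

/-- The complex form splits into the real forms of the real and imaginary parts:
`Σ_{pq} |K_{p,rev q} w_{rev q} + w_p K_{rev p,q}|² ≤ (10 + 2√13) Σ_a |w_a|²` for every `w : Fin 20 → ℂ`. -/
theorem ring6_complexForm_le (w : Fin 20 → ℂ) :
    ∑ p : Fin 20, ∑ q : Fin 20, ‖(r6K3 p q.rev : ℂ) * w q.rev + w p * (r6K3 p.rev q : ℂ)‖ ^ 2 ≤
      (10 + 2 * Real.sqrt 13) * ∑ a : Fin 20, ‖w a‖ ^ 2 := by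
  have hre : ∀ p q : Fin 20, ‖(r6K3 p q.rev : ℂ) * w q.rev + w p * (r6K3 p.rev q : ℂ)‖ ^ 2 =
      ((r6K3 p q.rev : ℝ) * (w q.rev).re + (w p).re * (r6K3 p.rev q : ℝ)) ^ 2 +
        ((r6K3 p q.rev : ℝ) * (w q.rev).im + (w p).im * (r6K3 p.rev q : ℝ)) ^ 2 := by
    intro p q
    rw [Complex.sq_norm, Complex.normSq_apply]
    simp only [Complex.add_re, Complex.add_im, Complex.mul_re, Complex.mul_im, Complex.intCast_re,
      Complex.intCast_im, mul_zero, zero_mul, sub_zero, add_zero]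
    ring
  have hw : ∀ a : Fin 20, ‖w a‖ ^ 2 = (w a).re ^ 2 + (w a).im ^ 2 := fun a => by
    rw [Complex.sq_norm, Complex.normSq_apply]; ring
  simp only [hre, hw, Finset.sum_add_distrib, mul_add]
  exact add_le_add (ring6_realForm_le_and_eq.1 fun a => (w a).re) (ring6_realForm_le_and_eq.1 fun a => (w a).im)

end Ring6Form

end Summit.Ventures.CertifiedQuantumChemistry

end
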